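import Summits.CriticalPhenomena.CardyFormulaZ2.Theorems.CardyFlipRussoSquareFromVoronoiHubDecimationDefs
import Literature.Probability.LatticeModels.DelaunayGraph
import HarnessLib

/-!
# Sketch (crux-ideate round 2, ideator 5) — first lemmas of three crux idea cards for
`SquareFromVoronoiHub` (stmt-CriticalPhenomena-6434)

* Card A `kw-odd-doublet-gap`: `CollinearPairKernel` — the single-model (G_s ≡ ℤ² ⊕ i.i.d. fair
  diagonals, by the landed centre-decimation identity) form of the kernel: quarter-turn-orbit sums of
  DOUBLE-flip responses at vertex-adjacent collinear face pairs are absolutely summable to `o(1)`.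
* Card B `one-product-leg`: `JitteredSquareDelaunay` — the endpoint of the single product leg is exactly
  "ℤ² + (one or, degenerately, two) diagonal(s) per face": Delaunay pairs of a jittered square lattice with
  jitter `a < (1 - 1/√2)/2` are king-move neighbours and contain every ℤ²-edge.
* Card C `harmonic-density-sum-rule`: `HarmonicDensityInvariance` — Cardy for annealed Poisson–Voronoi
  percolation (the crux's hypothesis) implies Cardy for Poisson–Voronoi percolation whose intensity has the
  log-harmonic density `|h'|²` (`h` conformal and injective near the closed domain).
-/

noncomputable section

open MeasureTheory Filter Set Metric
open scoped Topology

open Literature.Analysis.FunctionSpaces (PointConfig IsPoissonPointProcess)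
open Literature.Probability.RandomPlanarGeometry (ConformalRectangle cardyFunction)
open Literature.Probability.Percolation (SiteConfig sitePercolation siteConnIn half)
open Literature.Probability.LatticeModels (IsDelaunayPair)
open Summit.CriticalPhenomena.CardyFormulaZ2.Cruxes.SquareFromVoronoiHub.CentreDecimation
  (diagGraph diagLaw diagCrude faceWindow)

namespace Summit.CriticalPhenomena.CardyFormulaZ2.Cruxes.SquareFromVoronoiHub.IdeatorR2K5

/-! ### Card A — the collinear-pair (double-flip) kernel on the i.i.d. random-diagonal model -/

/-- Force the orientation of the diagonal of the face `f` (lower-left corner) in the orientation field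
`ζ`: `true` = SW–NE diagonal present (`f ∈ ζ`), `false` = SE–NW diagonal. -/
def forceDiag (ζ : Set (ℤ × ℤ)) (f : ℤ × ℤ) (a : Bool) : Set (ℤ × ℤ) :=
  if a then insert f ζ else ζ \ {f}

/-- The crude crossing probability of `R` (mesh `δ`, slack `c δ`) of the annealed random-diagonal model
CONDITIONED on the diagonals of the two faces `f`, `g` being `a`, `b` (conditioning on independent fair
coordinates = substitution under the product law `diagLaw`). -/
def condCrossingProb (R : ConformalRectangle) (c δ : ℝ) (f g : ℤ × ℤ) (a b : Bool) : ℝ :=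
  diagLaw.real {p | (forceDiag (forceDiag p.1 f a) g b, p.2) ∈ diagCrude R c δ}

/-- The DOUBLE-FLIP response `Δ_f Δ_g P[U]`: the mixed second difference of the crude crossing
probability in the diagonals of the faces `f` and `g`. -/
def doubleFlip (R : ConformalRectangle) (c δ : ℝ) (f g : ℤ × ℤ) : ℝ :=
  condCrossingProb R c δ f g true true - condCrossingProb R c δ f g true false
    - condCrossingProb R c δ f g false true + condCrossingProb R c δ f g false false

/-- The quarter-turn orbit (about the centre of the face `f`) of the faces sharing exactly one vertex
with `f`: the four vertex-adjacent COLLINEAR neighbours `f ± (1,1)`, `f ± (1,-1)`. -/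
def collinearNbrs (f : ℤ × ℤ) : Finset (ℤ × ℤ) :=
  {(f.1 + 1, f.2 + 1), (f.1 - 1, f.2 - 1), (f.1 + 1, f.2 - 1), (f.1 - 1, f.2 + 1)}

/-- The orbit sum `T_f = Σ_{g ∈ C₄·g₀} Δ_f Δ_g P[U]` — the summand of the leg-S Russo derivative at the
i.i.d. endpoint (coefficient of `(1-s)`), quarter-turn even by (PAR) and arc-odd by colour flip. -/
def orbitSum (R : ConformalRectangle) (c δ : ℝ) (f : ℤ × ℤ) : ℝ :=
  ∑ g ∈ collinearNbrs f, doubleFlip R c δ f g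

/-- **Card A, first lemma (`CollinearPairKernel`).**  For site percolation at 1/2 on ℤ² with i.i.d.
fair diagonals (≡ site percolation on `G_s` restricted to ℤ², landed `centreDecimationIdentity`):
the quarter-turn orbit sums of double-flip responses of the crude crossing event are ABSOLUTELY
summable to `o(1)` over the faces of the window, for every conformal rectangle and every slack
`c ≥ 2`.  KW-parity spectral prediction: `|T_f| ≍ δ^{5/4} (δ/d_f)^{11/4}` in the bulk (first KW-odd
scalar of the 4-leg sector at `x = 4`), so the sum is `O(δ^{1/4})`; a KW-odd scalar channel with
`x ≤ 2` would make it diverge or stay bounded away from `0`. -/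
def CollinearPairKernel : Prop :=
  ∀ (R : ConformalRectangle) (c : ℝ), 2 ≤ c → ∀ ε > (0 : ℝ),
    ∀ᶠ δ in 𝓝[>] (0 : ℝ), ∀ F : Finset (ℤ × ℤ), (↑F : Set (ℤ × ℤ)) ⊆ faceWindow R δ →
      ∑ f ∈ F, |orbitSum R c δ f| ≤ ε

/-! ### Card B — the endpoint of the single product leg -/

/-- The jittered square lattice `v ↦ v + ξ v` as a set of sites in `ℂ`. -/
def jitteredSquare (ξ : ℤ × ℤ → ℂ) : Set ℂ :=
  Set.range fun v : ℤ × ℤ => ((v.1 : ℂ) + (v.2 : ℂ) * Complex.I) + ξ v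

/-- **Card B, first lemma (`JitteredSquareDelaunay`).**  If every jitter has norm at most
`a < (1 - 1/√2)/2`, then (i) every nearest-neighbour pair of ℤ² is a Delaunay pair of the jittered
lattice (empty circumscribed ball rule) and (ii) every Delaunay pair is a king-move pair
(`|Δx| ≤ 1 ∧ |Δy| ≤ 1`): the Delaunay graph is ℤ² plus, in each face, one diagonal (both only in the
null event of a cocircular face).  Elementary geometry (covering radius `1/√2 + a < 1 - a`). -/
def JitteredSquareDelaunay : Prop :=
  ∀ (a : ℝ) (ξ : ℤ × ℤ → ℂ), 0 ≤ a → a < (1 - 1 / Real.sqrt 2) / 2 → (∀ v, ‖ξ v‖ ≤ a) →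
    (∀ v w : ℤ × ℤ, (w = (v.1 + 1, v.2) ∨ w = (v.1, v.2 + 1)) →
        IsDelaunayPair (jitteredSquare ξ) (((v.1 : ℂ) + (v.2 : ℂ) * Complex.I) + ξ v)
          (((w.1 : ℂ) + (w.2 : ℂ) * Complex.I) + ξ w)) ∧
    (∀ v w : ℤ × ℤ, v ≠ w →
        IsDelaunayPair (jitteredSquare ξ) (((v.1 : ℂ) + (v.2 : ℂ) * Complex.I) + ξ v)
          (((w.1 : ℂ) + (w.2 : ℂ) * Complex.I) + ξ w) →
        |v.1 - w.1| ≤ 1 ∧ |v.2 - w.2| ≤ 1)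

/-! ### Card C — harmonic density invariance from the crux's hypothesis -/

/-- The crux's hypothesis, verbatim: Cardy's formula for annealed Poisson–Voronoi percolation
(continuum-path event, nuclei of Lebesgue intensity read at scale `δ`). -/
def VoronoiCardy : Prop :=
  ∀ (PB PW : Measure (PointConfig ℂ)),
    IsPoissonPointProcess (volume : Measure ℂ) PB → IsPoissonPointProcess (volume : Measure ℂ) PW →
    ∀ R : ConformalRectangle, R.HasCrossingLimit
      (fun δ ↦ (PB.prod PW).real {c | ∃ x ∈ R.arc 0, ∃ y ∈ R.arc 2,
        JoinedIn (closure R.carrier ∩ {z | Metric.infDist (z / (δ : ℂ)) (c.1 : Set ℂ) ≤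
          Metric.infDist (z / (δ : ℂ)) (c.2 : Set ℂ)}) x y}) cardyFunction

/-- The inhomogeneous intensity at scale `δ`: density `ρ(δ w)` at the nucleus `w` (the density varies
on the DOMAIN scale; nuclei are read at scale `δ` as in the crux). -/
def scaledDensity (ρ : ℂ → ℝ) (δ : ℝ) : Measure ℂ :=
  (volume : Measure ℂ).withDensity fun w => ENNReal.ofReal (ρ ((δ : ℂ) * w))

/-- **Card C, first lemma (`HarmonicDensityInvariance`).**  Cardy for annealed homogeneous
Poisson–Voronoi percolation implies Cardy for Poisson–Voronoi percolation whose intensity density is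
`|h'|²` near the closed domain, for `h` holomorphic and injective on a neighbourhood `U ⊇ closure Ω`
(and any bounded measurable positive continuation outside `U`).  Proof route: `h` is an isometry from
`(U, |h'|²|dz|², |h'|² dA)` onto `(h U, Euclid, dA)`, so the model is the Benjamini–Schramm
conformal-METRIC perturbation of the homogeneous model on the conformal rectangle `h(R)` (same
cross-ratio); Benjamini–Schramm 1998 Thm 2.1 (metric invariance, proved) + the hypothesis. -/
def HarmonicDensityInvariance : Prop :=
  VoronoiCardy →
    ∀ (R : ConformalRectangle) (U : Set ℂ) (h : ℂ → ℂ) (ρ : ℂ → ℝ),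
      IsOpen U → closure R.carrier ⊆ U → DifferentiableOn ℂ h U → Set.InjOn h U →
      Measurable ρ → (∃ a b : ℝ, 0 < a ∧ ∀ z, a ≤ ρ z ∧ ρ z ≤ b) →
      (∀ z ∈ U, ρ z = ‖deriv h z‖ ^ 2) →
      ∀ (PB PW : ℝ → Measure (PointConfig ℂ)),
        (∀ δ, 0 < δ → IsPoissonPointProcess (scaledDensity ρ δ) (PB δ)) →
        (∀ δ, 0 < δ → IsPoissonPointProcess (scaledDensity ρ δ) (PW δ)) →
        R.HasCrossingLimit
          (fun δ ↦ ((PB δ).prod (PW δ)).real {c | ∃ x ∈ R.arc 0, ∃ y ∈ R.arc 2,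
            JoinedIn (closure R.carrier ∩ {z | Metric.infDist (z / (δ : ℂ)) (c.1 : Set ℂ) ≤
              Metric.infDist (z / (δ : ℂ)) (c.2 : Set ℂ)}) x y}) cardyFunction

/-! ### Sanity: the crux's hypothesis is literally `VoronoiCardy` (definitional unfolding) -/

/-- The crux unfolds to `VoronoiCardy → (its conclusion)`: feeding the hypothesis is application. -/
theorem crux_apply
    (h : Summit.CriticalPhenomena.CardyFormulaZ2.Theses.CardyFlipRusso.SquareFromVoronoiHub)
    (hV : VoronoiCardy) :
    (let z : (ℤ × ℤ) ⊕ (ℤ × ℤ) → ℂ := Sum.elim (fun x ↦ (x.1 : ℂ) + (x.2 : ℂ) * Complex.I) (fun f ↦ ((f.1 : ℂ) + 1 / 2) + ((f.2 : ℂ) + 1 / 2) * Complex.I); let G : SimpleGraph ((ℤ × ℤ) ⊕ (ℤ × ℤ)) := SimpleGraph.fromRel (fun a b ↦ a.isLeft = true ∧ ((b.isLeft = true ∧ dist (z a) (z b) = 1) ∨ (b.isRight = true ∧ dist (z a) (z b) < 1))); ∀ R : ConformalRectangle, R.HasCrossingLimit (fun δ ↦ (sitePercolation ((ℤ × ℤ)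 ⊕ (ℤ × ℤ)) half).real {ω | ∃ u v, Metric.infDist ((δ : ℂ) * z u) (R.arc 0) ≤ 2 * δ ∧ Metric.infDist ((δ : ℂ) * z v) (R.arc 2) ≤ 2 * δ ∧ ω ∈ siteConnIn G {y | (δ : ℂ) * z y ∈ R.carrier} u v}) cardyFunction) :=
  h hV

end Summit.CriticalPhenomena.CardyFormulaZ2.Cruxes.SquareFromVoronoiHub.IdeatorR2K5

end
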